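import Mathlib
import HarnessLib
import Summits.ResolutionOfSingularities.ResolutionOfSingularities.Theorems.WildQuotientsWildQuotientResolutionS1aLogExitFramesCone
import Literature.AlgebraicGeometry.Resolution.RsopMonomialIdeals
import Literature.AlgebraicGeometry.Resolution.AlterationsNodalMonomialization

/-!
# Line L exit — DIVISORIALITY of the cone chart (door rung D2; idea-1 target T1 = plan-1 (T11.6))

[OURS · L1 W4.5c · idea-1 g11, 2026-08-27; plan-1 ★ 23:39:37Z ASSIGNMENT «… then T1 divisorial_coneChart (Kato 11.6
analogue) as rungs of D2»; memos `L/res-L1-w45c-idea-1/f1/EXIT-DOOR-PLAN.md` fe7d390f95414a93 §5 T1, plan-1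
`L/w45c/EXIT-DOOR-DESIGN.md` v1 §4 (T11.6) «f invertible off ∪V(s_i) ⇒ f = unit · monomial»] — NOT a statement of the
manuscript; counted 0; AI-written and AI-reviewed only (weaker than expert review). Crux stmt-ResolutionOfSingularities-17941
(`WildQuotients.CyclicQuotientFourfolds`), skeleton line `s1a-logminvertex` v5 (door stub `stub_tameQuotientResolution`).
INDEPENDENT of parts 3–7 of the helper module: imports only the LANDED §5 (`…S1aLogExitFramesCone`, p572600: `charCone`)
and Literature. No `sorry`, no `instance`, no `notation`; Literature results CITED (`IsRsopPart`, `IsRsopPart.prime`,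
`exists_eq_units_mul_prod_pow_of_dvd_prod_pow`, `isDomain_of_isRegularLocalRing`).

At a TAME point (`B` regular local, graded by an abelian group `ι` with (R-triv): `𝒜 c ⊆ 𝔪_B` for `c ≠ 0`) with a
homogeneous regular system of parameters `s, χ` (the output of `f1LocTame` / `f1LocTame_adapted`), every DEGREE-`0`
divisor `t ∈ B₀` of a power of the boundary equation `∏ s_i` is a degree-`0` unit times a CONE MONOMIAL `s^m`,
`m ∈ P_χ = charCone χ`.  This is the ring-level content of the `chartStalkMonoid = divisorialMonoid` field of
`LocalLogRegularChart` for the cone chart (compare Literature `RootCover.divisorialMonoid_toric`, the Kummer case), i.e.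
Kato's Thm. 11.6 `M = 𝒪 ∩ j_* 𝒪^*_U` for these charts: the members of an r.s.p. are prime (`IsRsopPart.prime`), so a
divisor of `(∏ s_i)^N` is `ε · ∏ s_i^{n_i}` (`exists_eq_units_mul_prod_pow_of_dvd_prod_pow`); in the graded DOMAIN `B`
the unit `ε = t / s^n` is homogeneous (`mem_graded_of_mul_mem`), and a homogeneous unit has degree `0` by (R-triv),
forcing `Σ n_i • χ_i = 0`.  Axioms of `divisorial_coneChart`: `propext`, `Classical.choice`, `Quot.sound`.
Sources: [Kato1994] K. Kato, Toric singularities, Amer. J. Math. 116 (1994), Thm. 11.6; Abramovich–Temkin,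
arXiv:1407.2629, §4 (torific ideals; divisorial monoids of simple actions).
-/

set_option linter.dupNamespace false

noncomputable section

open Literature.AlgebraicGeometry.Resolution

namespace Summit.ResolutionOfSingularities.ResolutionOfSingularities.Theorems.WildQuotientResolution.S1.LogExitFrames

/-! ## §14 Divisoriality of the cone chart -/

section Divisorial

open DirectSum IsLocalRing

/-- **§14a (homogeneous quotients).** In a graded DOMAIN, if `x ≠ 0` is homogeneous of degree `i` and `x * y` is
homogeneous of degree `k`, then `y` is homogeneous of degree `k - i`. [OURS · L1 W4.5c; Mathlib
`DirectSum.coe_decompose_mul_add_of_left_mem`, `DirectSum.decompose_of_mem_ne`] -/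
theorem mem_graded_of_mul_mem {ι : Type*} [DecidableEq ι] [AddCommGroup ι] {B : Type*} [CommRing B] [IsDomain B]
    (𝒜 : ι → AddSubgroup B) [GradedRing 𝒜] {x y : B} {i k : ι} (hx : x ∈ 𝒜 i) (hx0 : x ≠ 0)
    (hxy : x * y ∈ 𝒜 k) : y ∈ 𝒜 (k - i) := by
  classical
  -- every component of `y` off degree `k - i` vanishes
  have hcomp : ∀ j, j ≠ k - i → (decompose 𝒜 y j : B) = 0 := by
    intro j hj
    have h1 : (decompose 𝒜 (x * y) (i + j) : B) = x * decompose 𝒜 y j :=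
      coe_decompose_mul_add_of_left_mem 𝒜 hx
    have h2 : (decompose 𝒜 (x * y) (i + j) : B) = 0 :=
      decompose_of_mem_ne 𝒜 hxy fun h => hj (by rw [h]; abel)
    rw [h2] at h1
    exact (mul_eq_zero.mp h1.symm).resolve_left hx0
  have hy : y = (decompose 𝒜 y (k - i) : B) := by
    conv_lhs => rw [← sum_support_decompose 𝒜 y]
    rw [Finset.sum_eq_single (k - i) (fun j _ hj => hcomp j hj)]
    intro hk
    rw [DFinsupp.mem_support_iff, not_not] at hk
    rw [hk]
    rfl
  rw [hy]
  exact (decompose 𝒜 y (k - i)).2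

/-- **§14b (T1) Divisoriality of the cone chart.** `B` regular local graded by an abelian group `ι` with (R-triv),
`s : Fin d → B` a homogeneous regular system of parameters (characters `χ`, `dim B = d`, `(s) = 𝔪_B`): a degree-`0`
element `t ∈ B₀` dividing a power of `∏ s_i` is `u · ∏ s_i^{m_i}` with `u ∈ B₀` a unit of `B` and `m` in the character
cone `P_χ` (`m ≥ 0`, `Σ m_i • χ_i = 0`). [OURS · L1 W4.5c; cites Literature `IsRsopPart.prime`,
`exists_eq_units_mul_prod_pow_of_dvd_prod_pow`, `isDomain_of_isRegularLocalRing`; Kato 1994 Thm. 11.6 analogue] -/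
theorem divisorial_coneChart (ι : Type) [AddCommGroup ι] [DecidableEq ι] (B : Type) [CommRing B]
    [IsRegularLocalRing B] (𝒜 : ι → AddSubgroup B) [GradedRing 𝒜]
    (hR : ∀ c : ι, c ≠ 0 → ∀ b ∈ 𝒜 c, b ∈ maximalIdeal B)
    {d : ℕ} (s : Fin d → B) (χ : Fin d → ι) (hs : ∀ i, s i ∈ 𝒜 (χ i))
    (hd : ringKrullDim B = d) (hspan : Ideal.span (Set.range s) = maximalIdeal B)
    {t : B} (ht0 : t ∈ 𝒜 0) {N : ℕ} (hdiv : t ∣ (∏ i, s i) ^ N) :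
    ∃ (u : B) (m : charCone χ), IsUnit u ∧ u ∈ 𝒜 0 ∧
      t = u * ∏ i, s i ^ ((m : Fin d → ℤ) i).toNat := by
  classical
  haveI := isDomain_of_isRegularLocalRing B
  have hrs : IsRsopPart s := by
    refine ⟨inferInstance, 0, Fin.elim0, by rw [Nat.add_zero]; exact hd, ?_⟩
    rw [Set.range_eq_empty (Fin.elim0 : Fin 0 → B), Set.union_empty]
    exact hspan
  have hprime : ∀ i ∈ (Finset.univ : Finset (Fin d)), Prime (s i) := fun i _ => hrs.prime i
  have hdiv' : t ∣ ∏ i ∈ (Finset.univ : Finset (Fin d)), s i ^ N := by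
    rwa [Finset.prod_pow]
  obtain ⟨n, ε, hε⟩ := exists_eq_units_mul_prod_pow_of_dvd_prod_pow Finset.univ s hprime N hdiv'
  -- degrees: the monomial has degree `δ`, the unit `ε` degree `-δ`, hence `δ = 0` by (R-triv)
  have hM : ∏ i, s i ^ n i ∈ 𝒜 (∑ i, n i • χ i) :=
    SetLike.prod_pow_mem_graded 𝒜 χ s n fun i _ => hs i
  have hM0 : ∏ i, s i ^ n i ≠ 0 :=
    Finset.prod_ne_zero_iff.mpr fun i _ => pow_ne_zero _ (hrs.prime i).ne_zero
  have hεdeg : (ε : B) ∈ 𝒜 (0 - ∑ i, n i • χ i) :=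
    mem_graded_of_mul_mem 𝒜 hM hM0 (by rw [mul_comm, ← hε]; exact ht0)
  have hδ : ∑ i, n i • χ i = 0 := by
    by_contra hne
    have hmem : (ε : B) ∈ maximalIdeal B := hR _ (by rwa [zero_sub, neg_ne_zero]) _ hεdeg
    exact (IsLocalRing.mem_maximalIdeal _).mp hmem ε.isUnit
  rw [hδ, sub_zero] at hεdeg
  refine ⟨ε, ⟨fun i => (n i : ℤ), fun i => Int.natCast_nonneg (n i), ?_⟩, ε.isUnit, hεdeg, ?_⟩
  · simpa only [natCast_zsmul] using hδ
  · simpa only [Int.toNat_natCast] using hε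

end Divisorial

end Summit.ResolutionOfSingularities.ResolutionOfSingularities.Theorems.WildQuotientResolution.S1.LogExitFrames

end
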